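/-
Origin: expansion seat `planner-pub-hodgecm-pohl-g5-0`, handover #2 2026-08-18T05:29:29Z (optional) (`HOME/pub-hodgecm-pohl-g5/lean/Pohl5/DegreeZeroCrossModel.lean`, md5 52e1438b, 66 lines);
landed by the gen-6 packager in gate run 23 as `HodgeCM/Proofs/Pohlmann/DegreeZeroCrossModel.lean` (import ^import Pohl5\.→import HodgeCM.Proofs.Pohlmann. ×1).
-/
/-
Copyright: pub-hodgecm formalisation cell (harness21, 2026). New file (not vendored).
Origin: HOME/pub-hodgecm-pohl-g5/lean/Pohl5/DegreeZeroCrossModel.lean — session planner-pub-hodgecm-pohl-g5-0 (unit pub-hodgecm-pohl-g5),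
part (b) `PohlmannSpan`, generation 5.  Intended final place: `HodgeCM/Proofs/Pohlmann/DegreeZeroCrossModel.lean`
(module `HodgeCM.Proofs.Pohlmann.DegreeZeroCrossModel`).  ADDITIVE.  WIP import `Pohl5.DegreeZero` = the handed-over
`HodgeCM/Proofs/Pohlmann/DegreeZero.lean` (rewrite to `import HodgeCM.Proofs.Pohlmann.DegreeZero` on landing); the other import,
`Proofs/Pohlmann/GaoUllmoCrossModel.lean` (cf-gaoullmo-g2), is in the run-22 frozen set.
-/
import Summits.HodgeConjecture.HodgeCM.Proofs.Pohlmann.DegreeZero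
import Summits.HodgeConjecture.HodgeCM.Proofs.Pohlmann.GaoUllmoCrossModel

/-!
# Cross-model count of Hodge classes in EVERY codimension `p ≥ 0`

`GaoUllmoCrossModel.lean` (cf-gaoullmo-g2) equates, for `p ≥ 1`, the package's `dim_ℚ B^p(∏_j A_{(F,Θ_j)})` (abstract
`Universe`, under `ModelAxioms` + N1–N4) with `dim_ℚ B^p` of Gao–Ullmo's exterior-algebra model (`GaoUllmo.Bp (piCMType Θ) p`,
kernel theorem `GaoUllmo.Theorem31_finrank_holds`), excluding `p = 0` because "`dim H⁰(A′) = 1` is connectedness, which is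
not a recorded model fact".  With `DegreeZero.lean` (`CMProdConnected`, a theorem of `ModelAxioms` + N1 + N3 + F6) the
restriction goes: the two counts agree for every `p ≥ 0` [Gao–Ullmo, JIMJ 25 (2025) Thm 3.1 "For each `p ≥ 0` … In particular
`dim_ℚ B^p(A)` is the number of ordered `P` … with `|P| = 2p` satisfying (3.2)", arXiv:2411.12249 p. 9 ll. 32–40].
-/

noncomputable section

namespace HodgeCM

namespace Universe

open Literature.AlgebraicGeometry.Motives (CMType)
open HodgeCM.GaoUllmo

variable {U : Universe}

/-- **Cross-model count, every `p ≥ 0`**: under `ModelAxioms` + N1–N4 + `CMProdConnected`, for `F` Galois CM and an ordering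
of `Hom(F^{n+1}, ℂ)` obeying Gao–Ullmo's convention, `dim_ℚ B^p(∏_j A_{(F,Θ_j)})` of the abstract universe equals `dim_ℚ B^p`
of Gao–Ullmo's model `⋀^{2p} ℚ^{Hom(F^{n+1},ℂ)}` — both being the number of Hodge weights (`finrank_hodgeClassesOf_all`,
`GaoUllmo.finrank_Bp_pi_eq_card_hodgeWeight`). -/
theorem finrank_hodgeClassesOf_eq_finrank_Bp_all (M : U.ModelAxioms) (hN1 : U.Fact_cupExterior) (hN2 : U.Fact_cup_hodge)
    (hN3 : U.Fact_pull_H0) (hN4 : U.Fact_hodge_F0) (h0 : U.CMProdConnected) (F : CMField) [IsGalois ℚ F] {n : ℕ}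
    (Θ : Fin (n + 1) → CMType F) [LinearOrder (Emb (Fin (n + 1) → (F : Type)))] (hord : OrderConvention (piCMType Θ))
    (p : ℕ) : Module.finrank ℚ (U.hodgeClassesOf (U.cmProd F Θ) p) = Module.finrank ℚ (Bp (piCMType Θ) p) := by
  rw [finrank_hodgeClassesOf_all (F := F) (n := n) (Θ := Θ) M hN1 hN2 hN3 hN4 h0 p,
    finrank_Bp_pi_eq_card_hodgeWeight Θ hord p]

/-- The same from the adjudicated binders `ModelAxioms` + N1–N4 + F6 `Fact_weightDual`. -/
theorem finrank_hodgeClassesOf_eq_finrank_Bp_of_facts (M : U.ModelAxioms) (hN1 : U.Fact_cupExterior)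
    (hN2 : U.Fact_cup_hodge) (hN3 : U.Fact_pull_H0) (hN4 : U.Fact_hodge_F0) (h6 : U.Fact_weightDual) (F : CMField)
    [IsGalois ℚ F] {n : ℕ} (Θ : Fin (n + 1) → CMType F) [LinearOrder (Emb (Fin (n + 1) → (F : Type)))]
    (hord : OrderConvention (piCMType Θ)) (p : ℕ) :
    Module.finrank ℚ (U.hodgeClassesOf (U.cmProd F Θ) p) = Module.finrank ℚ (Bp (piCMType Θ) p) :=
  finrank_hodgeClassesOf_eq_finrank_Bp_all M hN1 hN2 hN3 hN4 (cmProdConnected_of_facts M hN1 hN3 h6) F Θ hord p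

/-- The same with the order convention discharged (`GaoUllmo.exists_orderConvention`). -/
theorem exists_order_finrank_hodgeClassesOf_eq_finrank_Bp_all (M : U.ModelAxioms) (hN1 : U.Fact_cupExterior)
    (hN2 : U.Fact_cup_hodge) (hN3 : U.Fact_pull_H0) (hN4 : U.Fact_hodge_F0) (h0 : U.CMProdConnected) (F : CMField)
    [IsGalois ℚ F] {n : ℕ} (Θ : Fin (n + 1) → CMType F) (p : ℕ) :
    ∃ r : LinearOrder (Emb (Fin (n + 1) → (F : Type))), @OrderConvention _ _ _ r (piCMType Θ) ∧
      Module.finrank ℚ (U.hodgeClassesOf (U.cmProd F Θ) p) = Module.finrank ℚ (@Bp _ _ _ _ r (piCMType Θ) p) := by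
  obtain ⟨r, hr⟩ := exists_orderConvention (piCMType Θ)
  exact ⟨r, hr, @finrank_hodgeClassesOf_eq_finrank_Bp_all U M hN1 hN2 hN3 hN4 h0 F _ n Θ r hr p⟩

end Universe

end HodgeCM

end
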